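import Literature.Analysis.FluidPDE.FluidComputer.ThresholdLevelTableA5
import HarnessLib

/-!
# Kernel run of the A = 5 level-table checker, chunks 52 … 55 (steps 1300 … 1399) (bp3 gen 13, layer 4)

HONEST FRAMING: low prior, high value-of-information experiment on Tao's machine paradigm; NOT a
claim that NS blows up.

Four kernel evaluations (`decide +kernel`; no `native_decide`, no extra axioms) of the checker
`runSteps` (`ThresholdLevelCheck.lean`) on 25 steps of `ThresholdLevelTableA5.stepsT` at a time, from
the entry box `Bc i` towards the next chunk's first level, returning the entry box `Bc (i+1)`
(≈ 30 s of kernel time per chunk; same scheme as `ThresholdLevelTableRun0 … 7` for A = 2).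
-/

namespace Literature.Analysis.FluidPDE.FluidComputer

namespace ThresholdLevelTableA5

set_option maxHeartbeats 10000000 in
set_option maxRecDepth 200000 in
/-- Chunk 52 of the A = 5 table run (steps 1300 … 1324). [folklore] -/
theorem run52 : runSteps 60 12 3 GIt RbIt Bc52 chunk52 22702682000799772 = some Bc53 := by
  decide +kernel

set_option maxHeartbeats 10000000 in
set_option maxRecDepth 200000 in
/-- Chunk 53 of the A = 5 table run (steps 1325 … 1349). [folklore] -/
theorem run53 : runSteps 60 12 3 GIt RbIt Bc53 chunk53 24851131090678280 = some Bc54 := by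
  decide +kernel

set_option maxHeartbeats 10000000 in
set_option maxRecDepth 200000 in
/-- Chunk 54 of the A = 5 table run (steps 1350 … 1374). [folklore] -/
theorem run54 : runSteps 60 12 3 GIt RbIt Bc54 chunk54 27202896841189052 = some Bc55 := by
  decide +kernel

set_option maxHeartbeats 10000000 in
set_option maxRecDepth 200000 in
/-- Chunk 55 of the A = 5 table run (steps 1375 … 1399). [folklore] -/
theorem run55 : runSteps 60 12 3 GIt RbIt Bc55 chunk55 29777219952372684 = some Bc56 := by
  decide +kernel

end ThresholdLevelTableA5

end Literature.Analysis.FluidPDE.FluidComputer
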